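import Summits.ABC.IUTFork.Thm311RealDegreeClauseExists
import HarnessLib

/-!
# [IUTchIII] Theorem 3.11 (i)(c) at the real Dupuy–Hilado-volume instantiation — regions with COMPACT factors

Proof-only companion (D-0012; no definitions) of `Thm311RealDegreeClauseExists` (abc-iut cell, seat abc-iut-w4-d087
gen 2; support piece for node IUTchIII:Thm3.11(i), holder abc-iut-c312-1); TAKES NO SIDE on [IUTchIII] Cor. 3.12.
Print's admissible regions `𝕄(−)` are "a direct product of COMPACT subsets of positive measure in each of the direct
summands" ([IUTchIII] Rmk. 3.1.1 (iii), kurims `paper:url-4b091feeb646` p. 95 l. 28–30), while abc-iut-c312-3's typed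
`PacketAdm` (consumed by c312-5's verbatim container `Real.summandPiecesDH`) asks only positive finite measure. This
file records that the difference is immaterial for the degree clause: at every prime `p` and for EVERY real `t` there
is a direct product region of the `(j+1)`-packet of weighted log-volume `t` whose factors are admissible with COMPACT
image `ψ(R_{v⃗}) ⊆ ⊕_j L_j` under c312-3's decomposition (`Literature.IUT.LogVolume.exists_packetAdm_isCompact_packetLogμ_eq`:
compact subsets of prescribed Haar measure, via `Literature.MeasureTheory.Lebesgue.exists_isCompact_subset_measure_eq`),
so `Real.degreeClause_DHVol_of_localVolumes` is also witnessed by such regions. [claim: Mochizuki2012, status: disputed]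
[cite: DupuyHilado2025, Def. 3.5.1, Def. 3.6.1] Deliberately NOT here: any definition, any judgement.
-/

noncomputable section

open Set Function NumberField IsDedekindDomain

namespace Summit.ABC.IUTFork.Thm311

namespace Real

open Cor312 Cor312Vol Literature.IUT.LogThetaLattice Literature.IUT.LogVolume

variable {F : Type} [Field F] [NumberField F] (X : PilotData F) {logv : PadicLogs F} (hlog : LogvAnalytic logv)

/-- **At a prime `p`, with COMPACT factors**: for every label `j` and every real `t`, a direct product region
`e⁻¹(Π_{v⃗} R_{v⃗})` of the `(j+1)`-packet over `p` of weighted log-volume exactly `t` whose factors `R_{v⃗}` are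
admissible AND have compact image `ψ(R_{v⃗}) ⊆ ⊕_j L_j` — print's "direct product of compact subsets of positive measure
in each of the direct summands" ([IUTchIII] Rmk. 3.1.1 (iii) p. 95) read through c312-3's decomposition `ψ`.
[claim: Mochizuki2012, status: disputed] -/
theorem exists_adm_logvol_eq_inr_compact (p : ℕ) [hp : Fact p.Prime] (j : (thetaIndex X).Label) (t : ℝ) :
    ∃ R : ∀ e : (summandPiecesDH X hlog).E j (.inr (ratPrime p)),
        Set ((summandPiecesDH X hlog).X j (.inr (ratPrime p)) e),
      (∀ e, (summandPiecesDH X hlog).adm j (.inr (ratPrime p)) e (R e) ∧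
        IsCompact (dEquiv p ((padicPresentationDH X p logv (hlog (ratPrime p))).kk e) '' R e)) ∧
      (summandPiecesDH X hlog).Adm j (.inr (ratPrime p))
        ((summandPiecesDH X hlog).e j (.inr (ratPrime p)) ⁻¹' Set.pi univ R) ∧
      (summandPiecesDH X hlog).logvol j (.inr (ratPrime p))
        ((summandPiecesDH X hlog).e j (.inr (ratPrime p)) ⁻¹' Set.pi univ R) = t := by
  classical
  set V := summandPiecesDH X hlog with hV
  have hw : ∀ e : V.E j (.inr (ratPrime p)), V.w j (.inr (ratPrime p)) e = weightDH X j := fun _ => rfl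
  have hwpos : 0 < weightDH X j := by
    unfold weightDH
    have h : (0 : ℝ) < Module.finrank ℚ F := by exact_mod_cast Module.finrank_pos
    positivity
  haveI : Nonempty (V.E j (.inr (ratPrime p))) := by
    show Nonempty ((thetaIndex X).Caps j → (thetaIndex X).Fibre (.inr (ratPrime p)))
    infer_instance
  have hNpos : (0 : ℝ) < (Finset.univ : Finset (V.E j (.inr (ratPrime p)))).card := by
    exact_mod_cast Finset.univ_nonempty.card_pos
  set s : ℝ := t / ((Finset.univ : Finset (V.E j (.inr (ratPrime p)))).card * weightDH X j) with hs
  have key : ∀ e : V.E j (.inr (ratPrime p)), ∃ R : Set (V.X j (.inr (ratPrime p)) e),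
      V.adm j (.inr (ratPrime p)) e R ∧
        IsCompact (dEquiv p ((padicPresentationDH X p logv (hlog (ratPrime p))).kk e) '' R) ∧
        V.logμ j (.inr (ratPrime p)) e R = s := fun e =>
    exists_packetAdm_isCompact_packetLogμ_eq p ((padicPresentationDH X p logv (hlog (ratPrime p))).kk e) s
  choose R hRadm hRc hRvol using key
  refine ⟨R, fun e => ⟨hRadm e, hRc e⟩, V.adm_preimage_pi j (.inr (ratPrime p)) hRadm, ?_⟩
  rw [V.logvol_preimage_pi j (.inr (ratPrime p)) hRadm]
  simp_rw [hRvol, hw]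
  rw [Finset.sum_const, nsmul_eq_mul, hs]
  field_simp

/-- **The degree clause with compact-factor regions**: there is a region binder satisfying the degree clause of
`Real.situationDHVol` ALL of whose regions over primes are direct product regions with admissible, compact-image
factors (and the whole packet at `∞`). [claim: Mochizuki2012, status: disputed] -/
theorem exists_region_degreeClause_DHVol_compact
    (archPk : ∀ (j : (thetaIndex X).Label) (vQ : (thetaIndex X).VQ), Set ((logShellsDH X logv).Packet j vQ))
    (archSub : ∀ (j : (thetaIndex X).Label) (v : (thetaIndex X).V),
      Set ((logShellsDH X logv).Packet j ((thetaIndex X).over v)))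
    (Ψ : ℤ → ∀ v : (thetaIndex X).V, v ∈ (thetaIndex X).Vbad → Set ((logShellsDH X logv).StarPacket v))
    (act : ℤ → ∀ v : (thetaIndex X).V, v ∈ (thetaIndex X).Vbad →
      (logShellsDH X logv).StarPacket v → Module.End ℚ ((logShellsDH X logv).StarPacket v))
    (Mmod : ℤ → ∀ j : (thetaIndex X).LabelStar, Set ((logShellsDH X logv).GlobalPacket j.1)) :
    ∃ region : ℤ → ∀ j : (thetaIndex X).LabelStar, FinDivisor F → ∀ vQ : (thetaIndex X).VQ,
        Set ((logShellsDH X logv).Packet j.1 vQ),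
      Summit.ABC.IUTFork.Thm311.Situation.DegreeClause
          (situationDHVol X hlog F archPk archSub Ψ act Mmod region) ∧
        ∀ (n : ℤ) (j : (thetaIndex X).LabelStar) (J : FinDivisor F) (p : ℕ) (hp : Fact p.Prime),
          ∃ R : ∀ e : (summandPiecesDH X hlog).E j.1 (.inr (ratPrime p)),
              Set ((summandPiecesDH X hlog).X j.1 (.inr (ratPrime p)) e),
            region n j J (.inr (ratPrime p)) =
                (summandPiecesDH X hlog).e j.1 (.inr (ratPrime p)) ⁻¹' Set.pi univ R ∧
              ∀ e, (summandPiecesDH X hlog).adm j.1 (.inr (ratPrime p)) e (R e) ∧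
                IsCompact (dEquiv p ((padicPresentationDH X p logv (hlog (ratPrime p))).kk e) '' R e) := by
  classical
  -- at a prime: the compact-factor product region of the prescribed local degree; at ∞: the whole packet
  have hprime : ∀ (j : (thetaIndex X).Label) (p : ℕ) (hp : Fact p.Prime) (J : FinDivisor F),
      ∃ R : ∀ e : (summandPiecesDH X hlog).E j (.inr (ratPrime p)),
          Set ((summandPiecesDH X hlog).X j (.inr (ratPrime p)) e),
        (∀ e, (summandPiecesDH X hlog).adm j (.inr (ratPrime p)) e (R e) ∧
          IsCompact (dEquiv p ((padicPresentationDH X p logv (hlog (ratPrime p))).kk e) '' R e)) ∧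
        (summandPiecesDH X hlog).Adm j (.inr (ratPrime p))
          ((summandPiecesDH X hlog).e j (.inr (ratPrime p)) ⁻¹' Set.pi univ R) ∧
        (summandPiecesDH X hlog).logvol j (.inr (ratPrime p))
            ((summandPiecesDH X hlog).e j (.inr (ratPrime p)) ⁻¹' Set.pi univ R) =
          ∑ v ∈ J.support,
            if Place.under (Sum.inr v : Place F) = .inr (ratPrime p) then J v * logNorm F v else 0 :=
    fun j p hp J => exists_adm_logvol_eq_inr_compact X hlog p j _
  choose R hR using hprime
  obtain hinl := fun (u : Unit) (j : (thetaIndex X).Label) => exists_adm_logvol_eq_inl X hlog u j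
  choose A hA using hinl
  refine ⟨fun _ j J vQ => match vQ with
      | .inl u => A u j.1
      | .inr pp => (summandPiecesDH X hlog).e j.1 (.inr pp) ⁻¹' Set.pi univ (R j.1 pp.1 ⟨pp.2⟩ J), ?_, ?_⟩
  · refine degreeClause_DHVol_of_localVolumes X hlog archPk archSub Ψ act Mmod _ (fun n j J vQ => ?_)
      fun n j J vQ => ?_
    · rcases vQ with u | pp
      · exact (hA u j.1).1
      · exact (hR j.1 pp.1 ⟨pp.2⟩ J).2.1
    · rcases vQ with u | pp
      · rw [(hA u j.1).2]
        symm
        exact Finset.sum_eq_zero fun v _ =>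
          if_neg (show Place.under (Sum.inr v : Place F) ≠ Sum.inl u from Sum.inr_ne_inl)
      · exact (hR j.1 pp.1 ⟨pp.2⟩ J).2.2
  · intro n j J p hp
    exact ⟨R j.1 p hp J, rfl, (hR j.1 p hp J).1⟩

end Real

end Summit.ABC.IUTFork.Thm311

end
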